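/-
Copyright (c) 2026 the pub-hodgecm-mathlib formalisation cell (harness21).  Prover seat hodgecm-mathlib-K2Liu-p08 (g4), Track B «K2-LIT» ∕ hLiu418
#184♮, socket #42S organ S1 (ROAD W), brick F7c-S0 (LEAD F0P6-plan (g14) BATCH #3 11:15:51Z «F7c → p08»; organ lead K2Liu-p06 (g4) DESIGN-W3-v2 §1∕§4;
M-158b (q2) «counts on model coordinates BY VALUE»).  2026-09-04.  KERNEL: theorems only.
-/
import Mathlib.RingTheory.Ideal.Span
import Mathlib.Algebra.BigOperators.Ring.Finset
import Mathlib.Algebra.Order.BigOperators.Group.Finset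
import Mathlib.Data.Fintype.BigOperators
import Mathlib.Tactic.Ring
import Mathlib.Tactic.Linarith
import Mathlib.Tactic.LinearCombination
import HarnessLib

/-!
# Crux `HLiu418`, #42S-S1 ROAD W, brick F7c-S0: COUNTING IN A FINITE CHAIN RING `R = 𝒪_v ∕ 𝔭^m` BY VALUE
# (ideal membership by exponent, the preimage count `#{γ ∈ ϖ^kR : eγ ∈ ϖ^sR} = q^{m − max(k, s − v(e))}`, the kernel count of `(b, γ) ↦ ab + eγ` and its TAIL EXPANSION)

Cell `hodgecm-mathlib`, crux item hLiu418 = `stmt-HodgeConjecture-24832` (helper lane `--supports … --as helper`, count-neutral).  THEOREMS ONLY (no `def`, no instance,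
no notation, no named-fact hypothesis, no `sorry`).  PURE FINITE COMBINATORICS.  The ring of the truncated counts of organ S1 is `R = 𝒪_v∕𝔭_v^m` (resp. `𝒪_{E_w}∕ϖ^m`); following
M-158b (q2) it is taken BY VALUE: a finite commutative ring `R` with an element `ϖ` and numbers `m, q` (`1 < q`) such that
  (chain)  every `x ∈ R` is `u·ϖ^t` with `u ∈ Rˣ`, `t ≤ m`;   (card)  `#(ϖ^t R) = q^{m−t}` for `t ≤ m`
(`𝒪_v∕𝔭^m`: `q = #k_v`; `𝒪_{E_w}∕ϖ^m` at an inert `w`: `q = #k_w = q_v²` — the same letters serve ★ F7c-B's valuation inputs F7b-val).  From these two letters alone: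
* §1 `ϖ^m = 0`, `#R = q^m`, **`mem_span_pow_iff`** (`u·ϖ^s ∈ ϖ^tR ↔ t ≤ s` for `s,t ≤ m`), `mul_mem_span_pow_iff` (products), `not_isUnit_iff_mem_span` (the non-units are `ϖR`);
* §2 **`card_filter_mem_span_and_mul_mem`**: `#{γ ∈ ϖ^kR : e·γ ∈ ϖ^sR} = q^{m − max(k, s − s_e)}` for `e = u·ϖ^{s_e}` — the ONE counting letter behind every truncated count of the organ;
* §3 the KERNEL COUNT of the linear form `(b, γ) ↦ a·b + e·γ` on `ϖ^lR × ϖ^kR`: `card_ker_eq_mul` (`= #{b ∈ ϖ^lR : ab ∈ e·ϖ^kR} · #{γ ∈ ϖ^kR : eγ = 0}`, by translation along one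
  solution) and its evaluation; §4 the TAIL EXPANSION **`card_ker_sq_mul_eq_sum`**: `#ker² · q^{2(k+l)} = Σ_{t=0}^{m} w(t)·𝟙[aϖ^l ∈ ϖ^tR ∧ eϖ^k ∈ ϖ^tR]`, `w(0) = q^{2m}`,
  `w(t) = q^{2(m+t)} − q^{2(m+t−1)}` (Abel summation: the square of the kernel count is a telescoping sum of indicators of `«image ⊆ ϖ^tR»`) — the form in which the sums over
  `(a, c)` of F7c-S2 `K2LiuSplitTruncatedCountClosedForm` swap into sums over `t` of PRODUCTS of two counts of §2.
[Shimura1997, §13 (local densities)] [McDonald, Finite rings with identity (1974), Ch. XVII (finite chain rings)] — cited for orientation; everything here is proved from the two letters.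
HONEST LABEL.  Count-neutral helper; `HC_CM` is proved only modulo the 7 printed citations (2 remaining named inputs: hLiu418 = `stmt-HodgeConjecture-24832`,
h413 = `stmt-HodgeConjecture-24833`) until rung 0 closes.  NOT here: the instantiation `R := 𝒪_v∕𝔭^m` (one lemma for the organ lead ∕ F7b-val hand) and the split counts themselves (F7c-S1∕S2).

## References
* [Shimura1997] G. Shimura, *Euler products and Eisenstein series*, CBMS 93 (1997), §13.
-/

set_option autoImplicit false
set_option linter.dupNamespace false -- the mandated namespace repeats `HodgeConjecture.HodgeConjecture`

open Finset
open scoped Classical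

namespace Summit.HodgeConjecture.HodgeConjecture.Cruxes.HLiu418.K2LiuFiniteChainRingCounts

variable {R : Type*} [CommRing R] [Fintype R] {ϖ : R} {m q : ℕ}

/-! ## §1 Membership in `ϖ^tR` by exponent -/

omit [Fintype R] in
/-- `ϖ^s ∈ ϖ^tR` for `t ≤ s`. [folklore] -/
theorem pow_mem_span_pow {s t : ℕ} (h : t ≤ s) : ϖ ^ s ∈ Ideal.span ({ϖ ^ t} : Set R) :=
  Ideal.mem_span_singleton.2 (pow_dvd_pow ϖ h)

omit [Fintype R] in
/-- units do not matter: `u·x ∈ I ↔ x ∈ I`. [folklore] -/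
theorem unit_mul_mem_iff (u : Rˣ) (x : R) (I : Ideal R) : (u : R) * x ∈ I ↔ x ∈ I :=
  Ideal.unit_mul_mem_iff_mem I u.isUnit

/-- **(card) at `t = m`: `ϖ^m = 0`** (`#(ϖ^mR) = 1` and `0, ϖ^m ∈ ϖ^mR`). [cite: Shimura1997, §13] -/
theorem pow_eq_zero (hcard : ∀ t, t ≤ m → (univ.filter fun x : R => x ∈ Ideal.span ({ϖ ^ t} : Set R)).card = q ^ (m - t)) : ϖ ^ m = 0 := by
  have h1 : (univ.filter fun x : R => x ∈ Ideal.span ({ϖ ^ m} : Set R)).card = 1 := by rw [hcard m le_rfl, Nat.sub_self, pow_zero]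
  obtain ⟨a, ha⟩ := card_eq_one.1 h1
  have hmem : ∀ x : R, x ∈ Ideal.span ({ϖ ^ m} : Set R) → x = a := fun x hx => by
    have : x ∈ (univ.filter fun x : R => x ∈ Ideal.span ({ϖ ^ m} : Set R)) := mem_filter.2 ⟨mem_univ _, hx⟩
    rw [ha] at this
    exact mem_singleton.1 this
  rw [hmem _ (Ideal.subset_span rfl), ← hmem 0 (Ideal.zero_mem _)]

/-- `ϖ^n = 0` for `m ≤ n`. [folklore] -/
theorem pow_eq_zero_of_le (hcard : ∀ t, t ≤ m → (univ.filter fun x : R => x ∈ Ideal.span ({ϖ ^ t} : Set R)).card = q ^ (m - t)) {n : ℕ} (hn : m ≤ n) :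
    ϖ ^ n = 0 := by
  rw [← Nat.add_sub_cancel' hn, pow_add, pow_eq_zero hcard, zero_mul]

/-- **(card) at `t = 0`: `#R = q^m`**. [cite: Shimura1997, §13] -/
theorem card_univ_eq (hcard : ∀ t, t ≤ m → (univ.filter fun x : R => x ∈ Ideal.span ({ϖ ^ t} : Set R)).card = q ^ (m - t)) : Fintype.card R = q ^ m := by
  have h := hcard 0 (Nat.zero_le _)
  rw [Nat.sub_zero, pow_zero, Ideal.span_singleton_one] at h
  rw [← h, ← card_univ]
  exact (congrArg card (filter_true_of_mem fun x _ => Submodule.mem_top)).symm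

/-- **exponent comparison**: for `s, t ≤ m`, `ϖ^s ∈ ϖ^tR ↔ t ≤ s` (if `s < t` the inclusion `ϖ^sR ⊆ ϖ^tR` would give `q^{m−s} ≤ q^{m−t}`). [cite: Shimura1997, §13] -/
theorem pow_mem_span_pow_iff (hcard : ∀ t, t ≤ m → (univ.filter fun x : R => x ∈ Ideal.span ({ϖ ^ t} : Set R)).card = q ^ (m - t)) (hq : 1 < q)
    {s t : ℕ} (hs : s ≤ m) (ht : t ≤ m) : ϖ ^ s ∈ Ideal.span ({ϖ ^ t} : Set R) ↔ t ≤ s := by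
  refine ⟨fun h => ?_, pow_mem_span_pow⟩
  by_contra hts
  have hsub : (univ.filter fun x : R => x ∈ Ideal.span ({ϖ ^ s} : Set R)) ⊆ univ.filter fun x : R => x ∈ Ideal.span ({ϖ ^ t} : Set R) := by
    intro x hx
    rw [mem_filter] at hx ⊢
    exact ⟨hx.1, (Ideal.span_singleton_le_iff_mem _).2 h hx.2⟩
  have hle := card_le_card hsub
  rw [hcard s hs, hcard t ht, pow_le_pow_iff_right₀ hq] at hle
  omega

/-- **membership of a chain element**: `u·ϖ^s ∈ ϖ^tR ↔ t ≤ s` (`s, t ≤ m`). [cite: Shimura1997, §13] -/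
theorem mem_span_pow_iff (hcard : ∀ t, t ≤ m → (univ.filter fun x : R => x ∈ Ideal.span ({ϖ ^ t} : Set R)).card = q ^ (m - t)) (hq : 1 < q)
    {x : R} {u : Rˣ} {s : ℕ} (hx : x = (u : R) * ϖ ^ s) (hs : s ≤ m) {t : ℕ} (ht : t ≤ m) : x ∈ Ideal.span ({ϖ ^ t} : Set R) ↔ t ≤ s := by
  rw [hx, unit_mul_mem_iff, pow_mem_span_pow_iff hcard hq hs ht]

/-- **membership of a product of chain elements**: `(u·ϖ^s)(u′·ϖ^r) ∈ ϖ^tR ↔ t ≤ s + r` (`s ≤ m`, `t ≤ m`; for `s + r ≥ m` the product is `0`). [cite: Shimura1997, §13] -/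
theorem mul_mem_span_pow_iff (hcard : ∀ t, t ≤ m → (univ.filter fun x : R => x ∈ Ideal.span ({ϖ ^ t} : Set R)).card = q ^ (m - t)) (hq : 1 < q)
    {x y : R} {u u' : Rˣ} {s r : ℕ} (hx : x = (u : R) * ϖ ^ s) (hy : y = (u' : R) * ϖ ^ r) {t : ℕ} (ht : t ≤ m) :
    x * y ∈ Ideal.span ({ϖ ^ t} : Set R) ↔ t ≤ s + r := by
  have hxy : x * y = ((u * u' : Rˣ) : R) * ϖ ^ (s + r) := by rw [hx, hy, Units.val_mul, pow_add]; ring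
  by_cases hsr : s + r ≤ m
  · exact mem_span_pow_iff hcard hq hxy hsr ht
  · rw [hxy, pow_eq_zero_of_le hcard (le_of_not_ge hsr), mul_zero]
    exact ⟨fun _ => by omega, fun _ => Ideal.zero_mem _⟩

/-- `x·ϖ^n ∈ ϖ^tR ↔ t ≤ s + n` for `x = u·ϖ^s`. [folklore] -/
theorem mul_pow_mem_span_pow_iff (hcard : ∀ t, t ≤ m → (univ.filter fun x : R => x ∈ Ideal.span ({ϖ ^ t} : Set R)).card = q ^ (m - t)) (hq : 1 < q)
    {x : R} {u : Rˣ} {s : ℕ} (hx : x = (u : R) * ϖ ^ s) (n : ℕ) {t : ℕ} (ht : t ≤ m) : x * ϖ ^ n ∈ Ideal.span ({ϖ ^ t} : Set R) ↔ t ≤ s + n :=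
  mul_mem_span_pow_iff hcard hq hx (u' := 1) (by rw [Units.val_one, one_mul]) ht

/-- **the non-units are `ϖR`** (`1 ≤ m`): for a chain element `u·ϖ^s`, `¬IsUnit ↔ 1 ≤ s ↔ ∈ ϖR`; `ϖ` itself is not a unit since `#(ϖR) = q^{m−1} < q^m`. [cite: Shimura1997, §13] -/
theorem not_isUnit_iff_mem_span (hchain : ∀ x : R, ∃ t, t ≤ m ∧ ∃ u : Rˣ, x = (u : R) * ϖ ^ t)
    (hcard : ∀ t, t ≤ m → (univ.filter fun x : R => x ∈ Ideal.span ({ϖ ^ t} : Set R)).card = q ^ (m - t)) (hq : 1 < q) (hm : 1 ≤ m) (x : R) :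
    ¬ IsUnit x ↔ x ∈ Ideal.span ({ϖ} : Set R) := by
  have hϖ : ¬ IsUnit ϖ := by
    intro hu
    have htop : Ideal.span ({ϖ ^ 1} : Set R) = ⊤ := Ideal.span_singleton_eq_top.2 (by rw [pow_one]; exact hu)
    have h := hcard 1 hm
    rw [htop, filter_true_of_mem (fun x _ => Submodule.mem_top), card_univ, card_univ_eq hcard] at h
    have hlt : q ^ (m - 1) < q ^ m := Nat.pow_lt_pow_right hq (by omega)
    omega
  obtain ⟨s, hs, u, rfl⟩ := hchain x
  rw [unit_mul_mem_iff]
  constructor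
  · intro hx
    have hs0 : s ≠ 0 := by
      rintro rfl
      exact hx (by rw [pow_zero, mul_one]; exact u.isUnit)
    exact Ideal.mem_span_singleton.2 (dvd_pow_self ϖ hs0)
  · intro hx hu
    have hs0 : s ≠ 0 := by
      rintro rfl
      rw [pow_zero, Ideal.mem_span_singleton] at hx
      exact hϖ (isUnit_of_dvd_one hx)
    exact hϖ ((isUnit_pow_iff hs0).1 ((Units.isUnit_units_mul u _).1 hu))

/-! ## §2 The counting letter: `#{γ ∈ ϖ^kR : e·γ ∈ ϖ^sR}` -/

/-- **THE COUNTING LETTER.**  For `e = u·ϖ^{s_e}` (`s_e ≤ m`), `k ≤ m`, `s ≤ m`: `#{γ ∈ ϖ^kR : e·γ ∈ ϖ^sR} = q^{m − max(k, s − s_e)}` (the set IS `ϖ^{max(k, s−s_e)}R`).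
[cite: Shimura1997, §13] -/
theorem card_filter_mem_span_and_mul_mem (hchain : ∀ x : R, ∃ t, t ≤ m ∧ ∃ u : Rˣ, x = (u : R) * ϖ ^ t)
    (hcard : ∀ t, t ≤ m → (univ.filter fun x : R => x ∈ Ideal.span ({ϖ ^ t} : Set R)).card = q ^ (m - t)) (hq : 1 < q)
    {e : R} {u : Rˣ} {se : ℕ} (he : e = (u : R) * ϖ ^ se) {k s : ℕ} (hk : k ≤ m) (hs : s ≤ m) :
    (univ.filter fun γ : R => γ ∈ Ideal.span ({ϖ ^ k} : Set R) ∧ e * γ ∈ Ideal.span ({ϖ ^ s} : Set R)).card = q ^ (m - max k (s - se)) := by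
  have hmax : max k (s - se) ≤ m := max_le hk (le_trans (Nat.sub_le _ _) hs)
  rw [← hcard _ hmax]
  refine congrArg card (filter_congr fun γ _ => ?_)
  obtain ⟨r, hr, uγ, rfl⟩ := hchain γ
  rw [mem_span_pow_iff hcard hq rfl hr hk, mul_mem_span_pow_iff hcard hq he rfl hs, mem_span_pow_iff hcard hq rfl hr hmax, max_le_iff]
  omega

/-! ## §3 The kernel count of `(b, γ) ↦ a·b + e·γ` on `ϖ^lR × ϖ^kR` -/

/-- `e·ϖ^kR = ϖ^{min(s_e+k, m)}R`: `y = e·γ₀` for some `γ₀ ∈ ϖ^kR` iff `y ∈ ϖ^{min(s_e+k,m)}R`. [cite: Shimura1997, §13] -/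
theorem exists_mem_span_mul_eq_iff (hcard : ∀ t, t ≤ m → (univ.filter fun x : R => x ∈ Ideal.span ({ϖ ^ t} : Set R)).card = q ^ (m - t))
    {e : R} {u : Rˣ} {se : ℕ} (he : e = (u : R) * ϖ ^ se) (k : ℕ) (y : R) :
    (∃ γ₀ ∈ Ideal.span ({ϖ ^ k} : Set R), e * γ₀ = y) ↔ y ∈ Ideal.span ({ϖ ^ min (se + k) m} : Set R) := by
  constructor
  · rintro ⟨γ₀, hγ₀, rfl⟩
    obtain ⟨c, rfl⟩ := Ideal.mem_span_singleton'.1 hγ₀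
    have : e * (c * ϖ ^ k) = ((u : R) * c) * ϖ ^ (se + k) := by rw [he, pow_add]; ring
    rw [this]
    exact Ideal.mul_mem_left _ _ (pow_mem_span_pow (min_le_left _ _))
  · intro hy
    obtain ⟨c, rfl⟩ := Ideal.mem_span_singleton'.1 hy
    by_cases hsk : se + k ≤ m
    · rw [min_eq_left hsk]
      refine ⟨(↑u⁻¹ : R) * c * ϖ ^ k, Ideal.mul_mem_left _ _ (Ideal.subset_span rfl), ?_⟩
      rw [he, pow_add]
      calc (u : R) * ϖ ^ se * ((↑u⁻¹ : R) * c * ϖ ^ k) = ((u : R) * ↑u⁻¹) * c * (ϖ ^ se * ϖ ^ k) := by ring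
        _ = c * (ϖ ^ se * ϖ ^ k) := by rw [Units.mul_inv, one_mul]
    · rw [min_eq_right (le_of_not_ge hsk), pow_eq_zero hcard, mul_zero]
      exact ⟨0, Ideal.zero_mem _, by rw [mul_zero]⟩

/-- **translation**: if `a·b + e·γ₀ = 0` with `γ₀ ∈ ϖ^kR`, then `γ ↦ γ − γ₀` identifies `{γ ∈ ϖ^kR : ab + eγ = 0}` with `{γ ∈ ϖ^kR : eγ = 0}`. [folklore] -/
theorem card_filter_eq_of_solution (e y : R) (k : ℕ) {γ₀ : R} (hγ₀ : γ₀ ∈ Ideal.span ({ϖ ^ k} : Set R)) (h0 : y + e * γ₀ = 0) :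
    (univ.filter fun γ : R => γ ∈ Ideal.span ({ϖ ^ k} : Set R) ∧ y + e * γ = 0).card =
      (univ.filter fun γ : R => γ ∈ Ideal.span ({ϖ ^ k} : Set R) ∧ e * γ = 0).card := by
  refine card_nbij' (fun γ => γ - γ₀) (fun γ => γ + γ₀) (fun γ hγ => ?_) (fun γ hγ => ?_) (fun γ _ => sub_add_cancel γ γ₀) (fun γ _ => add_sub_cancel_right γ γ₀)
  · rw [mem_coe, mem_filter] at hγ ⊢
    refine ⟨mem_univ _, Ideal.sub_mem _ hγ.2.1 hγ₀, ?_⟩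
    linear_combination hγ.2.2 - h0
  · rw [mem_coe, mem_filter] at hγ ⊢
    refine ⟨mem_univ _, Ideal.add_mem _ hγ.2.1 hγ₀, ?_⟩
    linear_combination hγ.2.2 + h0

/-- **the `γ`-fibre**: `#{γ ∈ ϖ^kR : y + e·γ = 0} = 𝟙[y ∈ ϖ^{min(s_e+k,m)}R] · #{γ ∈ ϖ^kR : e·γ = 0}`. [cite: Shimura1997, §13] -/
theorem card_filter_fibre_eq (hcard : ∀ t, t ≤ m → (univ.filter fun x : R => x ∈ Ideal.span ({ϖ ^ t} : Set R)).card = q ^ (m - t))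
    {e : R} {u : Rˣ} {se : ℕ} (he : e = (u : R) * ϖ ^ se) (k : ℕ) (y : R) :
    (univ.filter fun γ : R => γ ∈ Ideal.span ({ϖ ^ k} : Set R) ∧ y + e * γ = 0).card =
      (if y ∈ Ideal.span ({ϖ ^ min (se + k) m} : Set R) then 1 else 0) * (univ.filter fun γ : R => γ ∈ Ideal.span ({ϖ ^ k} : Set R) ∧ e * γ = 0).card := by
  by_cases hy : y ∈ Ideal.span ({ϖ ^ min (se + k) m} : Set R)
  · rw [if_pos hy, one_mul]
    have hy' : -y ∈ Ideal.span ({ϖ ^ min (se + k) m} : Set R) := neg_mem_iff.2 hy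
    obtain ⟨γ₀, hγ₀, h0⟩ := (exists_mem_span_mul_eq_iff hcard he k (-y)).2 hy'
    exact card_filter_eq_of_solution e y k hγ₀ (by rw [h0, add_neg_cancel])
  · rw [if_neg hy, zero_mul]
    refine card_eq_zero.2 (filter_eq_empty_iff.2 fun γ _ h => hy ?_)
    have : -y = e * γ := by linear_combination -h.2
    rw [← neg_mem_iff, this]
    exact (exists_mem_span_mul_eq_iff hcard he k (e * γ)).1 ⟨γ, h.1, rfl⟩

/-- **THE KERNEL COUNT, STRUCTURE**: `#{(b, γ) ∈ ϖ^lR × ϖ^kR : a·b + e·γ = 0} = #{b ∈ ϖ^lR : a·b ∈ ϖ^{min(s_e+k,m)}R} · #{γ ∈ ϖ^kR : e·γ = 0}` (sum over `b` of the `γ`-fibres).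
[cite: Shimura1997, §13] -/
theorem card_ker_eq_mul (hcard : ∀ t, t ≤ m → (univ.filter fun x : R => x ∈ Ideal.span ({ϖ ^ t} : Set R)).card = q ^ (m - t))
    {e : R} {u : Rˣ} {se : ℕ} (he : e = (u : R) * ϖ ^ se) (a : R) (l k : ℕ) :
    (univ.filter fun p : R × R => p.1 ∈ Ideal.span ({ϖ ^ l} : Set R) ∧ p.2 ∈ Ideal.span ({ϖ ^ k} : Set R) ∧ a * p.1 + e * p.2 = 0).card =
      (univ.filter fun b : R => b ∈ Ideal.span ({ϖ ^ l} : Set R) ∧ a * b ∈ Ideal.span ({ϖ ^ min (se + k) m} : Set R)).card *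
        (univ.filter fun γ : R => γ ∈ Ideal.span ({ϖ ^ k} : Set R) ∧ e * γ = 0).card := by
  rw [card_filter, Fintype.sum_prod_type, card_filter, sum_mul]
  refine sum_congr rfl fun b _ => ?_
  by_cases hb : b ∈ Ideal.span ({ϖ ^ l} : Set R)
  · have h1 : (∑ γ : R, if b ∈ Ideal.span ({ϖ ^ l} : Set R) ∧ γ ∈ Ideal.span ({ϖ ^ k} : Set R) ∧ a * b + e * γ = 0 then 1 else 0) =
        (univ.filter fun γ : R => γ ∈ Ideal.span ({ϖ ^ k} : Set R) ∧ a * b + e * γ = 0).card := by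
      rw [card_filter]
      exact sum_congr rfl fun γ _ => by simp only [hb, true_and]
    rw [h1, card_filter_fibre_eq hcard he k (a * b)]
    simp only [hb, true_and]
  · simp only [hb, false_and, if_false, sum_const_zero, zero_mul]

/-- **THE KERNEL COUNT, VALUE**: for `a = u_a·ϖ^{s_a}`, `e = u_e·ϖ^{s_e}` (`s_a, s_e ≤ m`), `l, k ≤ m`:
`#{(b, γ) ∈ ϖ^lR × ϖ^kR : a·b + e·γ = 0} = q^{m − max(l, min(s_e+k,m) − s_a)} · q^{m − max(k, m − s_e)}`. [cite: Shimura1997, §13] -/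
theorem card_ker_eq (hchain : ∀ x : R, ∃ t, t ≤ m ∧ ∃ u : Rˣ, x = (u : R) * ϖ ^ t)
    (hcard : ∀ t, t ≤ m → (univ.filter fun x : R => x ∈ Ideal.span ({ϖ ^ t} : Set R)).card = q ^ (m - t)) (hq : 1 < q)
    {a e : R} {ua ue : Rˣ} {sa se : ℕ} (ha : a = (ua : R) * ϖ ^ sa) (he : e = (ue : R) * ϖ ^ se) {l k : ℕ} (hl : l ≤ m) (hk : k ≤ m) :
    (univ.filter fun p : R × R => p.1 ∈ Ideal.span ({ϖ ^ l} : Set R) ∧ p.2 ∈ Ideal.span ({ϖ ^ k} : Set R) ∧ a * p.1 + e * p.2 = 0).card =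
      q ^ (m - max l (min (se + k) m - sa)) * q ^ (m - max k (m - se)) := by
  rw [card_ker_eq_mul hcard he a l k, card_filter_mem_span_and_mul_mem hchain hcard hq ha hl (min_le_right _ _)]
  congr 1
  have h0 : (univ.filter fun γ : R => γ ∈ Ideal.span ({ϖ ^ k} : Set R) ∧ e * γ = 0) =
      univ.filter fun γ : R => γ ∈ Ideal.span ({ϖ ^ k} : Set R) ∧ e * γ ∈ Ideal.span ({ϖ ^ m} : Set R) := by
    refine filter_congr fun γ _ => ?_
    rw [pow_eq_zero hcard, Ideal.span_singleton_zero, Ideal.mem_bot]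
  rw [h0, card_filter_mem_span_and_mul_mem hchain hcard hq he hk le_rfl]

/-! ## §4 The tail expansion of the squared kernel count -/

/-- telescoping: `q^{2m} + Σ_{t=1}^{n} (q^{2(m+t)} − q^{2(m+t−1)}) = q^{2(m+n)}`. [folklore] -/
theorem sum_range_weight_eq (hq : 1 < q) (n : ℕ) :
    (∑ t ∈ range (n + 1), if t = 0 then q ^ (2 * m) else q ^ (2 * (m + t)) - q ^ (2 * (m + t - 1))) = q ^ (2 * (m + n)) := by
  induction n with
  | zero => simp
  | succ n ih =>
    rw [sum_range_succ, ih, if_neg (Nat.succ_ne_zero n), show m + (n + 1) - 1 = m + n by omega]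
    have : q ^ (2 * (m + n)) ≤ q ^ (2 * (m + (n + 1))) := Nat.pow_le_pow_right (by omega) (by omega)
    omega

/-- exponent bookkeeping for the kernel count: `(m − max(l, min(s_e+k,m) − s_a)) + (m − max(k, m − s_e)) + (k + l) = m + min(s_a + l, s_e + k, m)` (`s_a, s_e, k, l ≤ m`, `1 ≤ m`, `l ≤ 1`).
[folklore] -/
theorem exponent_bookkeeping {sa se k l : ℕ} (hsa : sa ≤ m) (hse : se ≤ m) (hk : k ≤ m) (hl : l ≤ 1) (hm : 1 ≤ m) :
    (m - max l (min (se + k) m - sa)) + (m - max k (m - se)) + (k + l) = m + min (min (sa + l) (se + k)) m := by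
  rcases le_total (se + k) m with h1 | h1
  · rw [min_eq_left h1]
    rcases le_total l (se + k - sa) with h2 | h2
    · rw [max_eq_right h2]
      rcases le_total k (m - se) with h3 | h3
      · rw [max_eq_right h3]; omega
      · rw [max_eq_left h3]; omega
    · rw [max_eq_left h2]
      rcases le_total k (m - se) with h3 | h3
      · rw [max_eq_right h3]; omega
      · rw [max_eq_left h3]; omega
  · rw [min_eq_right h1]
    rcases le_total l (m - sa) with h2 | h2
    · rw [max_eq_right h2]
      rcases le_total k (m - se) with h3 | h3
      · rw [max_eq_right h3]; omega
      · rw [max_eq_left h3]; omega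
    · rw [max_eq_left h2]
      rcases le_total k (m - se) with h3 | h3
      · rw [max_eq_right h3]; omega
      · rw [max_eq_left h3]; omega

/-- **THE TAIL EXPANSION.**  For `a = u_a·ϖ^{s_a}`, `e = u_e·ϖ^{s_e}` (`s_a, s_e ≤ m`), `l ≤ 1`, `k ≤ m`, `1 ≤ m`:
`#{(b,γ) ∈ ϖ^lR × ϖ^kR : ab + eγ = 0}² · q^{2(k+l)} = Σ_{t=0}^{m} w(t) · 𝟙[a·ϖ^l ∈ ϖ^tR ∧ e·ϖ^k ∈ ϖ^tR]`, `w(0) = q^{2m}`, `w(t) = q^{2(m+t)} − q^{2(m+t−1)}` — the kernel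
has `q^{m+τ−k−l}` elements with `ϖ^τR = a·ϖ^lR + e·ϖ^kR` the image, and `q^{2(m+τ)}` telescopes over the indicators `𝟙[image ⊆ ϖ^tR] = 𝟙[t ≤ τ]`.  The right-hand side no longer
mentions the exponents of `a, e`: summed over `(a, e)` it becomes a sum over `t` of products of two counting letters (§2). [cite: Shimura1997, §13] -/
theorem card_ker_sq_mul_eq_sum (hchain : ∀ x : R, ∃ t, t ≤ m ∧ ∃ u : Rˣ, x = (u : R) * ϖ ^ t)
    (hcard : ∀ t, t ≤ m → (univ.filter fun x : R => x ∈ Ideal.span ({ϖ ^ t} : Set R)).card = q ^ (m - t)) (hq : 1 < q) (hm : 1 ≤ m)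
    {a e : R} {ua ue : Rˣ} {sa se : ℕ} (ha : a = (ua : R) * ϖ ^ sa) (hsa : sa ≤ m) (he : e = (ue : R) * ϖ ^ se) (hse : se ≤ m) {l k : ℕ} (hl : l ≤ 1) (hk : k ≤ m) :
    (univ.filter fun p : R × R => p.1 ∈ Ideal.span ({ϖ ^ l} : Set R) ∧ p.2 ∈ Ideal.span ({ϖ ^ k} : Set R) ∧ a * p.1 + e * p.2 = 0).card ^ 2 * q ^ (2 * (k + l)) =
      ∑ t ∈ range (m + 1), (if t = 0 then q ^ (2 * m) else q ^ (2 * (m + t)) - q ^ (2 * (m + t - 1))) *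
        (if a * ϖ ^ l ∈ Ideal.span ({ϖ ^ t} : Set R) ∧ e * ϖ ^ k ∈ Ideal.span ({ϖ ^ t} : Set R) then 1 else 0) := by
  -- the kernel has `q^{m + τ − k − l}` elements
  have hτle : min (min (sa + l) (se + k)) m ≤ m := min_le_right _ _
  rw [card_ker_eq hchain hcard hq ha he (le_trans hl hm) hk, ← pow_add, ← pow_mul, ← pow_add,
    show (m - max l (min (se + k) m - sa) + (m - max k (m - se))) * 2 + 2 * (k + l) = 2 * (m + min (min (sa + l) (se + k)) m) by
      have := exponent_bookkeeping (m := m) hsa hse hk hl hm; omega]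
  -- the indicators are `𝟙[t ≤ τ]`
  rw [← sum_range_weight_eq (m := m) hq (min (min (sa + l) (se + k)) m)]
  have hind : ∀ t ∈ range (m + 1), (a * ϖ ^ l ∈ Ideal.span ({ϖ ^ t} : Set R) ∧ e * ϖ ^ k ∈ Ideal.span ({ϖ ^ t} : Set R)) ↔
      t ≤ min (min (sa + l) (se + k)) m := by
    intro t ht
    have htm : t ≤ m := Nat.lt_succ_iff.1 (mem_range.1 ht)
    rw [mul_pow_mem_span_pow_iff hcard hq ha l htm, mul_pow_mem_span_pow_iff hcard hq he k htm]
    simp only [le_min_iff]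
    tauto
  rw [← sum_filter_add_sum_filter_not (range (m + 1)) (fun t => t ≤ min (min (sa + l) (se + k)) m)]
  have hzero : (∑ t ∈ (range (m + 1)).filter (fun t => ¬ t ≤ min (min (sa + l) (se + k)) m),
      (if t = 0 then q ^ (2 * m) else q ^ (2 * (m + t)) - q ^ (2 * (m + t - 1))) *
        (if a * ϖ ^ l ∈ Ideal.span ({ϖ ^ t} : Set R) ∧ e * ϖ ^ k ∈ Ideal.span ({ϖ ^ t} : Set R) then 1 else 0)) = 0 := by
    refine sum_eq_zero fun t ht => ?_
    rw [mem_filter] at ht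
    rw [if_neg (fun h => ht.2 ((hind t ht.1).1 h)), mul_zero]
  rw [hzero, add_zero]
  have hrange : (range (m + 1)).filter (fun t => t ≤ min (min (sa + l) (se + k)) m) = range (min (min (sa + l) (se + k)) m + 1) := by
    ext t
    simp only [mem_filter, mem_range]
    omega
  rw [hrange]
  refine sum_congr rfl fun t ht => ?_
  have ht' : t ∈ range (m + 1) := mem_range.2 (by have := mem_range.1 ht; omega)
  rw [if_pos ((hind t ht').2 (by have := mem_range.1 ht; omega)), mul_one]

end Summit.HodgeConjecture.HodgeConjecture.Cruxes.HLiu418.K2LiuFiniteChainRingCounts
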